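import Literature.NumberTheory.Automorphic.ShimuraCurveIdealsPrincipal
import Literature.NumberTheory.Automorphic.BrandtModuleChains
import Literature.NumberTheory.Automorphic.BrandtModuleLocal
import Literature.NumberTheory.Automorphic.BrandtModuleResidue
import Literature.NumberTheory.Automorphic.QuaternionInvolutionToolkit
import HarnessLib

/-!
# Principal left ideals of bounded norm vs. integral right ideals of the Eichler order of
# `X₀^D(M)`

Topic `NumberTheory/Automorphic`; theorems only (no definition, no named fact, no instance).
For a Shimura curve datum `X : ShimuraCurveData D M` with `D > 1`, `M ≥ 1` (`O = X.O` an
Eichler order of level `M` in the indefinite division quaternion algebra `B = X.B` of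
discriminant `D`), the number of principal left ideals `O α` with `α ∈ O`, `0 < nrd α ≤ N`
equals `∑_{n=1}^{N} a(n)`, where `a(n)` is the number of invertible (= locally principal)
integral right `O`-ideals of index `n²`
(`ShimuraCurveData.card_leftIdeals_eq_sum_card_integralIdeals`). Ingredients: the standard
involution `x ↦ x̄` exchanges `O α` and `ᾱ O` and preserves `O` and `nrd`
(`IsZOrder.standardInvolution_mem`, `standardInvolution_mul_rev`); a principal ideal `β O`,
`β ∈ O`, is an invertible integral right ideal of index `nrd(β)²`
(`Brandt.cast_relIndex_units_smul_eq_reducedNorm_sq`); and, conversely, every invertible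
integral right ideal is `β O` with `nrd β > 0` — Eichler's theorem
`ShimuraCurveData.exists_eq_units_smul_of_pos`. This is the bridge between the orbit count of
`ShimuraCurveOrbitIdealCount.lean` and the ideal-count asymptotics of
`ShimuraCurveIdealCountAsymptotics.lean` in Eichler's computation of the covolume of `O¹`
(Vignéras IV §1, §3 / V §2), on the way to
`Literature.NumberTheory.Automorphic.ShimuraCurveData.volume_fd_eq`.

## References

* M.-F. Vignéras, *Arithmétique des algèbres de quaternions*, LNM 800 (1980), Ch. III §5,
  Ch. V §2 [VignerasLNM800].
* M. Eichler, *Lectures on modular correspondences*, TIFR Lectures on Mathematics 9 (1955–56), §§10–14.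
-/

open scoped Pointwise

namespace Literature.NumberTheory.Automorphic

/-! ### Counting over a disjoint family indexed by a finset -/

/-- `#{x | ∃ n ∈ s, Q n x} = ∑_{n ∈ s} #{x | Q n x}` for finite, pairwise incompatible fibres.
[folklore] -/
theorem ncard_setOf_exists_mem_eq_sum {α : Type*} (s : Finset ℕ) (Q : ℕ → α → Prop)
    (hfin : ∀ n ∈ s, {x | Q n x}.Finite) (huniq : ∀ x n n', Q n x → Q n' x → n = n') :
    {x | ∃ n ∈ s, Q n x}.Finite ∧ {x | ∃ n ∈ s, Q n x}.ncard = ∑ n ∈ s, {x | Q n x}.ncard := by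
  classical
  induction s using Finset.induction_on with
  | empty => simp
  | insert a s ha ih =>
    obtain ⟨ihfin, ihcard⟩ := ih fun n hn => hfin n (Finset.mem_insert_of_mem hn)
    have hset : {x | ∃ n ∈ insert a s, Q n x} = {x | Q a x} ∪ {x | ∃ n ∈ s, Q n x} := by
      ext x
      simp only [Finset.mem_insert, Set.mem_setOf_eq, Set.mem_union]
      constructor
      · rintro ⟨n, rfl | hn, hQ⟩
        · exact Or.inl hQ
        · exact Or.inr ⟨n, hn, hQ⟩
      · rintro (hQ | ⟨n, hn, hQ⟩)
        · exact ⟨a, Or.inl rfl, hQ⟩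
        · exact ⟨n, Or.inr hn, hQ⟩
    have hdisj : Disjoint {x | Q a x} {x | ∃ n ∈ s, Q n x} := by
      rw [Set.disjoint_left]
      rintro x hxa ⟨n, hn, hxn⟩
      exact ha (huniq x a n hxa hxn ▸ hn)
    have hfa := hfin a (Finset.mem_insert_self a s)
    rw [hset, Finset.sum_insert ha, Set.ncard_union_eq hdisj hfa ihfin, ihcard]
    exact ⟨hfa.union ihfin, rfl⟩

namespace ShimuraCurveData

variable {D M : ℕ} (X : ShimuraCurveData D M)

/-! ### The involution exchanges principal left and right ideals -/

/-- `Ō = O` for the Eichler order of a datum (orders are stable under the standard involution).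
[cite: VignerasLNM800, Ch. I §4 Lemme 4.12] -/
theorem image_standardInvolution_O :
    standardInvolution ℚ X.B '' (X.O : Set X.B) = X.O := by
  ext x
  constructor
  · rintro ⟨y, hy, rfl⟩
    exact X.isZOrder.standardInvolution_mem hy
  · intro hx
    exact ⟨standardInvolution ℚ X.B x, X.isZOrder.standardInvolution_mem hx,
      standardInvolution_standardInvolution ℚ x⟩

/-- `(O α)‾ = ᾱ O`. [folklore] -/
theorem image_standardInvolution_leftIdeal (α : X.B) :
    standardInvolution ℚ X.B '' ((fun o : X.B => o * α) '' (X.O : Set X.B)) =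
      (fun o : X.B => standardInvolution ℚ X.B α * o) '' (X.O : Set X.B) := by
  rw [Set.image_image]
  conv_rhs => rw [← X.image_standardInvolution_O, Set.image_image]
  refine Set.image_congr fun o _ => ?_
  rw [standardInvolution_mul_rev]

/-- `(β O)‾ = O β̄`. [folklore] -/
theorem image_standardInvolution_rightIdeal (β : X.B) :
    standardInvolution ℚ X.B '' ((fun o : X.B => β * o) '' (X.O : Set X.B)) =
      (fun o : X.B => o * standardInvolution ℚ X.B β) '' (X.O : Set X.B) := by
  rw [Set.image_image]
  conv_rhs => rw [← X.image_standardInvolution_O, Set.image_image]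
  refine Set.image_congr fun o _ => ?_
  rw [standardInvolution_mul_rev]

/-- **`#{O α} = #{β O}`** over generators in `O` with `0 < nrd ≤ T`: the standard involution is a
bijection between the two families. [folklore] -/
theorem ncard_leftIdeals_eq_ncard_rightIdeals (T : ℝ) :
    {I : Set X.B | ∃ α ∈ X.O, 0 < reducedNorm ℚ X.B α ∧ ((reducedNorm ℚ X.B α : ℚ) : ℝ) ≤ T ∧
        I = (fun o : X.B => o * α) '' (X.O : Set X.B)}.ncard =
      {J : Set X.B | ∃ β ∈ X.O, 0 < reducedNorm ℚ X.B β ∧ ((reducedNorm ℚ X.B β : ℚ) : ℝ) ≤ T ∧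
        J = (fun o : X.B => β * o) '' (X.O : Set X.B)}.ncard := by
  set σ : Set X.B → Set X.B := fun S => standardInvolution ℚ X.B '' S with hσ
  have hσinj : Function.Injective σ := by
    have hinv : Function.Involutive σ := fun S => by
      simp only [hσ, Set.image_image, standardInvolution_standardInvolution, Set.image_id']
    exact hinv.injective
  rw [← Set.ncard_image_of_injective _ hσinj]
  congr 1
  ext J
  simp only [Set.mem_image, Set.mem_setOf_eq]
  constructor
  · rintro ⟨I, ⟨α, hαO, hpos, hle, rfl⟩, rfl⟩
    refine ⟨standardInvolution ℚ X.B α, X.isZOrder.standardInvolution_mem hαO, ?_, ?_, ?_⟩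
    · rwa [reducedNorm_standardInvolution]
    · rwa [reducedNorm_standardInvolution]
    · exact X.image_standardInvolution_leftIdeal α
  · rintro ⟨β, hβO, hpos, hle, rfl⟩
    refine ⟨(fun o : X.B => o * standardInvolution ℚ X.B β) '' (X.O : Set X.B),
      ⟨standardInvolution ℚ X.B β, X.isZOrder.standardInvolution_mem hβO, ?_, ?_, rfl⟩, ?_⟩
    · rwa [reducedNorm_standardInvolution]
    · rwa [reducedNorm_standardInvolution]
    · rw [hσ]
      simp only
      rw [X.image_standardInvolution_leftIdeal, standardInvolution_standardInvolution]

/-! ### Principal right ideals `β O` are the invertible integral right ideals -/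

/-- The set of principal right ideals `β O` (`β ∈ O`, `0 < nrd β ≤ N`), as subsets of `B`, is the
image of the set of invertible integral right `O`-ideals of index `n²`, `1 ≤ n ≤ N` (`D > 1`;
uses Eichler's theorem `exists_eq_units_smul_of_pos`). [cite: VignerasLNM800, Ch. III §5 Cor. 5.7] -/
theorem image_coe_integralIdeals_eq (hD : 1 < D) (hM : 0 < M) (N : ℕ) :
    (fun I : Submodule ℤ X.B => (I : Set X.B)) ''
        {I : Submodule ℤ X.B | IsInvertibleRightIdeal X.O I ∧ I ≤ X.O ∧
          ∃ n ∈ Finset.Icc 1 N, I.toAddSubgroup.relIndex X.O.toAddSubgroup = n ^ 2} =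
      {J : Set X.B | ∃ β ∈ X.O, 0 < reducedNorm ℚ X.B β ∧ ((reducedNorm ℚ X.B β : ℚ) : ℝ) ≤ N ∧
        J = (fun o : X.B => β * o) '' (X.O : Set X.B)} := by
  classical
  haveI := X.nontrivial_B
  haveI := X.charZero_B
  have hdiv : ∀ x : X.B, x ≠ 0 → IsUnit x := fun x hx => X.isUnit_of_ne_zero hD x hx
  have hZO := X.isZOrder
  have hcoe : ∀ u : (X.B)ˣ, ((u • X.O : Submodule ℤ X.B) : Set X.B) =
      (fun o : X.B => (u : X.B) * o) '' (X.O : Set X.B) := fun u => by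
    rw [Units.smul_def, Submodule.coe_pointwise_smul, ← Set.image_smul]
    rfl
  have hidx : ∀ u : (X.B)ˣ, (u : X.B) ∈ X.O →
      (((u • X.O).toAddSubgroup.relIndex X.O.toAddSubgroup : ℕ) : ℚ) = reducedNorm ℚ X.B u ^ 2 := by
    intro u hu
    have hleft : (u : X.B) ∈ Brandt.leftOrder X.O := by rw [hZO.toIsOrder.leftOrder_eq]; exact hu
    exact Brandt.cast_relIndex_units_smul_eq_reducedNorm_sq hZO.isFullLattice hleft
  ext J
  simp only [Set.mem_image, Set.mem_setOf_eq, Finset.mem_Icc]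
  constructor
  · rintro ⟨I, ⟨hI, hIO, n, ⟨hn1, hnN⟩, hIn⟩, rfl⟩
    obtain ⟨u, huO, hpos, rfl⟩ := X.exists_eq_units_smul_of_pos hD hM hI hIO
    refine ⟨u, huO, hpos, ?_, hcoe u⟩
    have h := hidx u huO
    rw [hIn] at h
    push_cast at h
    have hn : reducedNorm ℚ X.B u = n := by
      rw [← sq_eq_sq₀ hpos.le (by positivity), ← h]
    rw [hn]
    exact_mod_cast hnN
  · rintro ⟨β, hβO, hpos, hle, rfl⟩
    have hβ0 : β ≠ 0 := by
      rintro rfl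
      rw [reducedNorm_apply_zero] at hpos
      exact lt_irrefl _ hpos
    set u : (X.B)ˣ := (hdiv β hβ0).unit with hudef
    have hu : (u : X.B) = β := (hdiv β hβ0).unit_spec
    obtain ⟨k, hk⟩ := hZO.exists_int_reducedNorm hβO
    have hk0 : 0 < k := by
      have : (0 : ℚ) < k := hk ▸ hpos
      exact_mod_cast this
    refine ⟨u • X.O, ⟨hZO.isInvertibleRightIdeal_self.units_smul u, ?_, k.toNat, ⟨by omega, ?_⟩, ?_⟩,
      by rw [hcoe u, hu]⟩
    · have hleft : (u : X.B) ∈ Brandt.leftOrder X.O := by rw [hZO.toIsOrder.leftOrder_eq, hu]; exact hβO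
      exact (Brandt.units_smul_le_iff_mem_leftOrder X.O u).mpr hleft
    · have h : ((k.toNat : ℕ) : ℝ) = ((reducedNorm ℚ X.B β : ℚ) : ℝ) := by
        rw [hk, Rat.cast_intCast, ← Int.cast_natCast, Int.toNat_of_nonneg hk0.le]
      have : ((k.toNat : ℕ) : ℝ) ≤ N := h ▸ hle
      exact_mod_cast this
    · have h := hidx u (hu ▸ hβO)
      rw [hu, hk] at h
      have h' : (((u • X.O).toAddSubgroup.relIndex X.O.toAddSubgroup : ℕ) : ℚ) =
          ((k.toNat ^ 2 : ℕ) : ℚ) := by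
        rw [h, Nat.cast_pow, ← Int.cast_natCast, Int.toNat_of_nonneg hk0.le]
      exact_mod_cast h'

/-! ### The bridge -/

/-- **`#{O α : α ∈ O, 0 < nrd α ≤ N} = ∑_{n=1}^{N} a(n)`**, `a(n)` the number of invertible
integral right `O`-ideals of index `n²`, for the Eichler order of a Shimura curve datum with
`D > 1` (involution `O α ↔ ᾱ O` and Eichler's theorem that these are all the invertible integral
right ideals). [cite: VignerasLNM800, Ch. III §5 Cor. 5.7 and Ch. V §2] -/
theorem card_leftIdeals_eq_sum_card_integralIdeals (hD : 1 < D) (hM : 0 < M) (N : ℕ) :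
    Nat.card {I : Set X.B | ∃ α ∈ X.O, 0 < reducedNorm ℚ X.B α ∧
        ((reducedNorm ℚ X.B α : ℚ) : ℝ) ≤ (N : ℝ) ∧ I = (fun o : X.B => o * α) '' (X.O : Set X.B)} =
      ∑ n ∈ Finset.Icc 1 N, Nat.card {I : invertibleRightIdeals X.O //
        (I : Submodule ℤ X.B) ≤ X.O ∧
          (I : Submodule ℤ X.B).toAddSubgroup.relIndex X.O.toAddSubgroup = n ^ 2} := by
  classical
  haveI := X.nontrivial_B
  haveI := X.charZero_B
  haveI : IsAddTorsionFree X.B := isAddTorsionFree_of_charZero_module ℚ X.B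
  rw [Nat.card_coe_set_eq, X.ncard_leftIdeals_eq_ncard_rightIdeals, ← X.image_coe_integralIdeals_eq hD hM N,
    Set.ncard_image_of_injective _ SetLike.coe_injective]
  -- split over `n`
  set Q : ℕ → Submodule ℤ X.B → Prop := fun n I => IsInvertibleRightIdeal X.O I ∧ I ≤ X.O ∧
    I.toAddSubgroup.relIndex X.O.toAddSubgroup = n ^ 2 with hQ
  have hset : {I : Submodule ℤ X.B | IsInvertibleRightIdeal X.O I ∧ I ≤ X.O ∧
      ∃ n ∈ Finset.Icc 1 N, I.toAddSubgroup.relIndex X.O.toAddSubgroup = n ^ 2} =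
      {I | ∃ n ∈ Finset.Icc 1 N, Q n I} := by
    ext I
    simp only [hQ, Set.mem_setOf_eq]
    constructor
    · rintro ⟨h1, h2, n, hn, h3⟩; exact ⟨n, hn, h1, h2, h3⟩
    · rintro ⟨n, hn, h1, h2, h3⟩; exact ⟨h1, h2, n, hn, h3⟩
  have hfin : ∀ n ∈ Finset.Icc 1 N, {I | Q n I}.Finite := by
    intro n hn
    have hn0 : n ^ 2 ≠ 0 := pow_ne_zero 2 (by have := (Finset.mem_Icc.mp hn).1; omega)
    refine (finite_setOf_le_and_relIndex_eq X.O X.isZOrder.isFullLattice.1 hn0).subset ?_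
    rintro I ⟨-, hIO, hidx⟩
    exact ⟨hIO, hidx⟩
  have huniq : ∀ I n n', Q n I → Q n' I → n = n' := by
    rintro I n n' ⟨-, -, h⟩ ⟨-, -, h'⟩
    exact Nat.pow_left_injective (by norm_num) (h.symm.trans h')
  rw [hset, (ncard_setOf_exists_mem_eq_sum (Finset.Icc 1 N) Q hfin huniq).2]
  refine Finset.sum_congr rfl fun n _ => ?_
  rw [← Nat.card_coe_set_eq]
  refine Nat.card_congr ?_
  exact { toFun := fun I => ⟨⟨I.1, I.2.1⟩, I.2.2⟩
          invFun := fun I => ⟨I.1.1, I.1.2, I.2⟩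
          left_inv := fun I => rfl
          right_inv := fun I => rfl }

end ShimuraCurveData

end Literature.NumberTheory.Automorphic
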